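import Mathlib
import HarnessLib

/-!
# Zero-mode action floor — a family of cut-offs on `ℝ⁴` (lead c7, line `zero-mode-floor-dilute-gas` of
crux `NestedDissectionSea.EarlyCrosserLaw`, stmt-QuantumFields-13995)

Helper for the registered stub `stub_floorAssembly`: smooth cut-offs `χ_R` with `χ_R = 1` on the
closed ball of radius `R`, `0 ≤ χ_R ≤ 1`, compact support, and `‖dχ_R‖ ≤ C/R` with `C` independent
of `R` (scaling of one fixed bump function).
-/

noncomputable section

open scoped ContDiff Topology
open Metric

namespace Summit.QuantumFields.QCD.Cruxes.EarlyCrosserLaw.ZeroModeFloorDiluteGas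

/-- **Cut-off family.**  There is `C > 0` such that for every `R > 0` some smooth compactly supported
`χ : ℝ⁴ → [0,1]` equals `1` on `‖x‖ ≤ R` and has `‖fderiv ℝ χ x‖ ≤ C / R` everywhere. -/
theorem exists_cutoff_family :
    ∃ C : ℝ, 0 < C ∧ ∀ R : ℝ, 0 < R → ∃ χ : EuclideanSpace ℝ (Fin 4) → ℝ,
      ContDiff ℝ ∞ χ ∧ HasCompactSupport χ ∧ (∀ x, ‖x‖ ≤ R → χ x = 1) ∧ (∀ x, 0 ≤ χ x) ∧
      (∀ x, χ x ≤ 1) ∧ (∀ x, ‖fderiv ℝ χ x‖ ≤ C / R) := by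
  -- one fixed bump
  let χ₁ : ContDiffBump (0 : EuclideanSpace ℝ (Fin 4)) := ⟨1, 2, one_pos, by norm_num⟩
  have hχ₁ : ContDiff ℝ ∞ (χ₁ : EuclideanSpace ℝ (Fin 4) → ℝ) := χ₁.contDiff
  have hχ₁s : HasCompactSupport (χ₁ : EuclideanSpace ℝ (Fin 4) → ℝ) := χ₁.hasCompactSupport
  have hχ₁1 : ContDiff ℝ 1 (χ₁ : EuclideanSpace ℝ (Fin 4) → ℝ) := hχ₁.of_le (by exact_mod_cast le_top)
  obtain ⟨C₀, hC₀⟩ := ((hχ₁1.continuous_fderiv one_ne_zero)).bounded_above_of_compact_support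
    (hχ₁s.fderiv (𝕜 := ℝ))
  refine ⟨max C₀ 1, lt_max_of_lt_right one_pos, fun R hR => ?_⟩
  have hR0 : R ≠ 0 := hR.ne'
  -- the scaled cut-off
  let L : EuclideanSpace ℝ (Fin 4) →L[ℝ] EuclideanSpace ℝ (Fin 4) := R⁻¹ • ContinuousLinearMap.id ℝ _
  have hL : ∀ x, L x = R⁻¹ • x := fun x => rfl
  refine ⟨fun x => χ₁ (R⁻¹ • x), ?_, ?_, ?_, ?_, ?_, ?_⟩
  · exact hχ₁.comp (contDiff_id.const_smul R⁻¹)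
  · have h := hχ₁s.comp_homeomorph (Homeomorph.smulOfNeZero R⁻¹ (inv_ne_zero hR0))
    exact h
  · intro x hx
    apply χ₁.one_of_mem_closedBall
    simp only [mem_closedBall, dist_zero_right, norm_smul, norm_inv, Real.norm_eq_abs, abs_of_pos hR]
    rw [inv_mul_le_iff₀ hR]
    have : χ₁.rIn = 1 := rfl
    rw [this, mul_one]
    exact hx
  · intro x; exact χ₁.nonneg
  · intro x; exact χ₁.le_one
  · intro x
    have hd : DifferentiableAt ℝ (χ₁ : EuclideanSpace ℝ (Fin 4) → ℝ) (L x) :=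
      (hχ₁1.differentiable one_ne_zero) _
    have hcomp : fderiv ℝ (fun x => χ₁ (R⁻¹ • x)) x = (fderiv ℝ (χ₁ : _ → ℝ) (L x)).comp L := by
      have : (fun x => χ₁ (R⁻¹ • x)) = (χ₁ : _ → ℝ) ∘ L := rfl
      rw [this, fderiv_comp x hd L.differentiableAt, L.fderiv]
    rw [hcomp]
    calc ‖(fderiv ℝ (χ₁ : _ → ℝ) (L x)).comp L‖ ≤ ‖fderiv ℝ (χ₁ : _ → ℝ) (L x)‖ * ‖L‖ :=
          ContinuousLinearMap.opNorm_comp_le _ _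
      _ ≤ C₀ * R⁻¹ := by
          refine mul_le_mul (hC₀ _) ?_ (norm_nonneg _) ((norm_nonneg _).trans (hC₀ (L x)))
          calc ‖L‖ ≤ ‖(R⁻¹ : ℝ)‖ * ‖ContinuousLinearMap.id ℝ (EuclideanSpace ℝ (Fin 4))‖ :=
                norm_smul_le (R⁻¹ : ℝ) (ContinuousLinearMap.id ℝ (EuclideanSpace ℝ (Fin 4)))
            _ ≤ R⁻¹ * 1 := by
                rw [Real.norm_eq_abs, abs_of_pos (inv_pos.2 hR)]
                exact mul_le_mul_of_nonneg_left ContinuousLinearMap.norm_id_le (inv_pos.2 hR).le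
            _ = R⁻¹ := mul_one _
      _ ≤ max C₀ 1 / R := by
          rw [div_eq_mul_inv]
          exact mul_le_mul_of_nonneg_right (le_max_left _ _) (inv_pos.2 hR).le

end Summit.QuantumFields.QCD.Cruxes.EarlyCrosserLaw.ZeroModeFloorDiluteGas

end
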